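import Summits.RiemannHypothesis.RiemannHypothesis.Theorems.LittlewoodRadarDoor
import HarnessLib

/-!
# The θ-radar door, re-keyed on the repaired crux (`DoorOfPintzPos`, item stmt-RiemannHypothesis-23725)

Route `LittlewoodRadar` (sub-problem `RiemannHypothesis`). The original crux `PintzLocalisation`
(item 24249) is misstated: its binder `∀ Y : ℝ` is guarded only by `10^4(1+log(|γ|+5)) ≤ Real.log Y`,
and for `Y < 0` Mathlib's `Real.log Y = Real.log |Y|`, `Y ^ r = exp (r log |Y|) cos (r π)` make the
window `[Y, Y ^ r]` empty whenever `cos (r π) < 0`. The repaired crux `PintzLocalisationPos` adds the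
guard `0 < Y`; the door bookkeeping of `Theorems/LittlewoodRadarDoor.lean` (`exp_key`,
`envelope_broken`, `window_budget`) transfers verbatim because the localisation is applied at the
positive Pintz point `Y = exp(A+B)`. Main results: `door_core_pos`, `doorOfPintzPos_proof : DoorOfPintzPos`.
Nothing here bears on the truth of RH.
-/

set_option linter.dupNamespace false

noncomputable section

namespace Summit.RiemannHypothesis.RiemannHypothesis.Theorems.LittlewoodRadar

open Real
open Summit.RiemannHypothesis.RiemannHypothesis.Theses.LittlewoodRadar

/-- Core: a zero with `β ≥ 1/2 + η`, `|γ| ≤ T` breaks the envelope inside the window. [folklore] -/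
theorem door_core_pos (hP : PintzLocalisationPos) {η T : ℝ} (hη : 0 < η) (hη2 : η ≤ 1 / 2) (hT : 16 ≤ T)
    {ρ : ℂ} (hζ : riemannZeta ρ = 0) (h0 : 0 < ρ.re) (h1 : ρ.re < 1) (hγ : |ρ.im| ≤ T)
    (hβ : 1 / 2 + η ≤ ρ.re) :
    ∃ x : ℝ, 599 ≤ x ∧ x ≤ Real.exp (10 ^ 9 * Real.log T ^ 2 * (1 + |Real.log η|) / η) ∧
      Real.sqrt x * Real.log x ^ 2 / (8 * Real.pi) < |Chebyshev.theta x - x| := by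
  set A : ℝ := 10 ^ 4 * (1 + Real.log (T + 5)) with hA
  set B : ℝ := 2 / η * (Real.log (T + 5) + 2 * |Real.log η| + 3) with hB
  have hℓ5 : 0 ≤ Real.log (T + 5) := Real.log_nonneg (by linarith)
  have hγ5 : 1 ≤ |ρ.im| + 5 := by linarith [abs_nonneg ρ.im]
  have hlogγ : Real.log (|ρ.im| + 5) ≤ Real.log (T + 5) :=
    Real.log_le_log (by linarith [abs_nonneg ρ.im]) (by linarith)
  have hlogγ0 : 0 ≤ Real.log (|ρ.im| + 5) := Real.log_nonneg hγ5
  have hA0 : 0 ≤ A := by positivity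
  have hB0 : 0 ≤ B := by positivity
  -- the Pintz point
  set Y : ℝ := Real.exp (A + B) with hY
  have hY0 : 0 < Y := Real.exp_pos _
  have hlogY : Real.log Y = A + B := Real.log_exp _
  have hthr : 10 ^ 4 * (1 + Real.log (|ρ.im| + 5)) ≤ Real.log Y := by
    rw [hlogY]; nlinarith
  obtain ⟨x, hYx, hxY, hPx⟩ := hP ρ hζ h0 h1 Y hY0 hthr
  have hx0 : 0 < x := lt_of_lt_of_le hY0 hYx
  -- log x ≥ A + B
  have hlogx : A + B ≤ Real.log x := by
    rw [← hlogY]; exact Real.log_le_log hY0 hYx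
  -- x ≥ 599 : log x ≥ A ≥ 10^4
  have hx599 : 599 ≤ x := by
    have hlx : (7 : ℝ) ≤ Real.log x := by nlinarith
    have : Real.exp 7 ≤ x := by rwa [← Real.le_log_iff_exp_le hx0]
    have h7 : (599 : ℝ) ≤ Real.exp 7 := by
      have h27 : (2.7 : ℝ) ≤ Real.exp 1 := by linarith [Real.exp_one_gt_d9]
      have e7 : Real.exp 7 = Real.exp 1 ^ 7 := by rw [← Real.exp_nat_mul]; norm_num
      have hp := pow_le_pow_left₀ (by norm_num : (0 : ℝ) ≤ 2.7) h27 7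
      rw [e7]; norm_num at hp; linarith
    linarith
  refine ⟨x, hx599, ?_, ?_⟩
  · -- window
    have hxle : Real.log x ≤ 10 ^ 4 * Real.log (|ρ.im| + 5) * (A + B) := by
      have := Real.log_le_log hx0 hxY
      rwa [Real.log_rpow hY0, hlogY] at this
    have hxle' : Real.log x ≤ (A + B) * (10 ^ 4 * Real.log (T + 5)) :=
      calc Real.log x ≤ 10 ^ 4 * Real.log (|ρ.im| + 5) * (A + B) := hxle
        _ ≤ 10 ^ 4 * Real.log (T + 5) * (A + B) := by gcongr
        _ = (A + B) * (10 ^ 4 * Real.log (T + 5)) := by ring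
    have hbud := window_budget hη hη2 hT
    rw [← Real.exp_log hx0]
    exact Real.exp_le_exp.2 (hxle'.trans hbud)
  · -- envelope
    have hρn : ‖ρ‖ ≤ T + 5 := by
      have h := Complex.norm_le_abs_re_add_abs_im ρ
      have : |ρ.re| < 1 := by rw [abs_lt]; constructor <;> linarith
      linarith
    have hρ0 : 0 < ‖ρ‖ := by
      rw [norm_pos_iff]; intro h; rw [h] at h0; simp at h0
    have hkey : (T + 5) * Real.log x ^ 2 ≤ Real.exp (η * Real.log x) :=
      exp_key (M := T + 5) hη hη2 (by linarith) (hB ▸ (le_of_add_le_of_nonneg_right hlogx hA0))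
    exact envelope_broken hx599 hkey hρn hρ0 hβ hPx

/-- **`DoorOfPintzPos` (item stmt-RiemannHypothesis-23725): the θ-radar door `ThetaRadarDoor` from the repaired crux `PintzLocalisationPos`.** [folklore] -/
theorem doorOfPintzPos_proof : DoorOfPintzPos := by
  intro hP η T hη hη2 hT s hs h0 h1 hγ hoff
  by_cases hβ : 1 / 2 ≤ s.re
  · -- β ≥ 1/2: offset gives β ≥ 1/2 + η
    have hβ' : 1 / 2 + η ≤ s.re := by
      rw [abs_of_nonneg (by linarith)] at hoff; linarith
    exact door_core_pos hP hη hη2 hT hs h0 h1 hγ hβ'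
  · -- β < 1/2: reflect
    rw [not_le] at hβ
    have hs' := Literature.NumberTheory.LFunctions.GeneralizedRH.riemannZeta_one_sub_eq_zero hs h0 h1
    have hre : (1 - s).re = 1 - s.re := by simp
    have him : (1 - s).im = -s.im := by simp
    have hβ' : 1 / 2 + η ≤ (1 - s).re := by
      rw [hre]; rw [abs_of_neg (by linarith)] at hoff; linarith
    exact door_core_pos hP hη hη2 hT hs' (by rw [hre]; linarith) (by rw [hre]; linarith)
      (by rw [him, abs_neg]; exact hγ) hβ'

end Summit.RiemannHypothesis.RiemannHypothesis.Theorems.LittlewoodRadar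

end
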